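import Summits.AtomisticToContinuum.BoseEinsteinCondensation.Theorems.BECThomsonPrincipleGDTransferSeededIntegrableDefs

/-!
# Route `BECThomsonPrinciple`, crux `GDTransfer` (stmt-AtomisticToContinuum-9482), line `seeded-continuity`
# (skeleton v7) — registered stub `stub_localConstancyInt`: local constancy of the law of near-minimisers in the
# side, for SQUARE-INTEGRABLE admissible profiles, given the integrable transport device and the count law

Supports (does not close) stmt-AtomisticToContinuum-9482.

**Statement** (`Sig.stub_localConstancyInt = NearMinPhaseInt → PairPotentialBoundInt → DilationL32 → CountLaw →
∀ v, IsRepulsiveFiniteRange v → IsSqIntegrableProfile v → LocalConstancy v`).  At fixed particle number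
`N = m + 1` and every side `L₁ > 0` the periodic ground-state energy is finite, and for every `ε > 0` there are a
radius `r > 0` and a slack `δ₁ > 0` such that for every side `L'` with `|L' − L₁| < r` some slack `δ' > 0` makes
the condensed-side mass `hiMass = P(n̂₀ ≥ (1−β)N)` of every `δ'`-near-minimiser at `L'` and of every
`δ₁`-near-minimiser at `L₁` agree within `ε` — for measurable finite-range profiles that are finite on `[0, ∞)`
with square-integrable radial lift, GIVEN the three statements of the integrable transport device
(`NearMinPhaseInt`, `PairPotentialBoundInt`, `DilationL32`, all HYPOTHESES here) and `CountLaw`.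

**Proof** (c3's `stub_localConstancyBdd`, p155201, and c1's `stub_localConstancy`, p138765, with the bounded-class
inputs replaced by the integrable device statements).
* Symmetrise the profile, `u r = v|r|` (same energies; measurable, of range `R₀`, finite on all of `ℝ`, and with
  the same radial lift `u‖x‖ = v‖x‖`); the lift is in `L¹(ℝ³)` and `L^{3/2}(ℝ³)` by `lintegral_le_of_sq` /
  `lintegral_rpow_le_of_sq`.
* `E₀ = E₀(u, N, L₁) < ∞` and the `L²`-closeness of near-minimisers up to a phase at `(N, L₁)` are the two halves of
  `NearMinPhaseInt` (fed with the `L¹` lift).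
* LAW STABILITY at `(N, L₁)` (`hiMass_toReal_close_of_phaseClose`, the proof of `lawMass_le_of_nearMinimisers` /
  `hiMass_toReal_close_of_nearMinimisers` with the phase closeness as a hypothesis: the `L²`-Lipschitz bound of the
  law, `CountLaw` (2), the phase covariance `w_S(cΞ) = w_S(Ξ)`, masses `≤ 1` by `CountLaw` (1)) gives a tolerance
  `δ`; pick a real `δ' > 0` below it and put `η = δ'/4`.
* TRANSPORT (`scaledClose_of_int`, the proof of `stub_scaledCloseBdd` over (D') + (E')): at the finite kinetic
  budgets `K₀ = E₀ + η` and `K₁ = E₀ + 3η` with tolerance `η` we get `ϑ₁, ϑ₂ > 0` such that the energies of `u` and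
  of `b⁻²u(·/b)` are `η`-close both ways on states of kinetic energy `≤ K₀` (resp. `≤ K₁`) for `|b − 1| < ϑ₁`
  (resp. `ϑ₂`).  For `|L' − L₁| < r = min(L₁/2, ϑL₁/2)`, `ϑ = min ϑ₁ ϑ₂`, put `b = L₁/L'` and dilate,
  `Φ = Ψ'_b`: `hiMass Φ = hiMass Ψ'` (`hiMass_dilate`), `E_{b⁻²u(·/b)}(Φ) = b⁻²E_u(Ψ') ≤ E₀(b⁻²u(·/b), L₁) + η`
  for a `b²η`-near-minimiser `Ψ'` at `L'` (`periodicEnergy_dilate`, `periodicGroundStateEnergy_scaledPotential`),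
  `E₀(b⁻²u(·/b), L₁) ≤ E₀ + 2η` (test an `η`-near-minimiser of `u`, kinetic energy `≤ K₀`), so
  `T(Φ) ≤ E₀ + 3η = K₁` and `E_u(Φ) ≤ E₀ + 4η = E₀ + δ' ≤ E₀ + δ`: with `δ₁ = δ'` law stability applies to
  `(Φ, Ψ₁)`.

## References

* [LSSY2005] E. H. Lieb, R. Seiringer, J. P. Solovej, J. Yngvason, *The Mathematics of the Bose Gas and
  its Condensation*, Birkhäuser (2005): Ch. 5, footnote to (5.3) (scaling of the torus problem); §1.2 (1.16),
  Ch. 2 (2.1) (the admissible class: measurable, finite range).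
* [ReedSimonIV1978] M. Reed, B. Simon, *Methods of Modern Mathematical Physics IV*, Academic Press (1978),
  Thm XIII.1 and §XIII.12 (nondegenerate ground states).
-/

noncomputable section

open MeasureTheory Filter Set Metric
open scoped ENNReal NNReal

namespace Summit.AtomisticToContinuum.BoseEinsteinCondensation.Cruxes.GDTransfer.Seeded

open Literature.MathematicalPhysics.QuantumManyBody.BoseGas
open Literature.Barriers.AtomisticToContinuum.BoseGas (scaledPotential periodicEnergy_dilate
  periodicGroundStateEnergy_scaledPotential)

/-! ## Law stability at fixed `(N, L)` from the phase closeness of near-minimisers -/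

/-- **Law stability between two near-minimisers at fixed `(N, L)`, from phase closeness.**  Assume the
`L²`-Lipschitz bound of the law (`CountLaw` (2)) and that for every `η > 0` some slack `δ > 0` makes any two
`δ`-near-minimisers of `u` at `(N, L)` `η`-close in `L²(cell^N)` up to a phase.  Then for a set of counts `A` and
`ε > 0` there is `δ > 0` such that any two `δ`-near-minimisers `Θ, Ξ` satisfy `P_Θ(n̂₀ ∈ A) ≤ P_Ξ(n̂₀ ∈ A) + ε`
(`η = min(ε/3, 1)`, `2η + η² ≤ ε`; the law of `cΞ` is that of `Ξ`, `compMass_phase_mul`). [folklore] -/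
private theorem lawMass_le_of_phaseClose (hC : CountLaw) {u : ℝ → ℝ≥0∞} (m : ℕ) {L : ℝ} (hL : 0 < L)
    (hph : ∀ η : ℝ, 0 < η → ∃ δ : ℝ≥0∞, 0 < δ ∧ ∀ Ψ Φ : PeriodicTrialState (m + 1) L,
      periodicEnergy u Ψ ≤ periodicGroundStateEnergy u (m + 1) L + δ →
      periodicEnergy u Φ ≤ periodicGroundStateEnergy u (m + 1) L + δ →
      ∃ c : ℂ, ‖c‖ = 1 ∧
        ∫⁻ X in cellN (m + 1) L, (‖Ψ.ψ X - c * Φ.ψ X‖₊ : ℝ≥0∞) ^ 2 ≤ ENNReal.ofReal (η ^ 2))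
    (p : ℕ → Prop) [DecidablePred p] {ε : ℝ} (hε : 0 < ε) :
    ∃ δ : ℝ≥0∞, 0 < δ ∧ ∀ Θ Ξ : PeriodicTrialState (m + 1) L,
      periodicEnergy u Θ ≤ periodicGroundStateEnergy u (m + 1) L + δ →
      periodicEnergy u Ξ ≤ periodicGroundStateEnergy u (m + 1) L + δ →
      lawMass m L p Θ.ψ ≤ lawMass m L p Ξ.ψ + ENNReal.ofReal ε := by
  -- adapted from `lawMass_le_of_nearMinimisers` (…GDTransferSeededNearMinPhase.lean)
  set η : ℝ := min (ε / 3) 1 with hη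
  have hη0 : 0 < η := lt_min (by linarith) one_pos
  have hηε : 2 * η + η ^ 2 ≤ ε := by nlinarith [min_le_left (ε / 3) 1, min_le_right (ε / 3) 1]
  obtain ⟨δ, hδ0, hδ⟩ := hph η hη0
  refine ⟨δ, hδ0, fun Θ Ξ hΘ hΞ => ?_⟩
  obtain ⟨c, hc, hcell⟩ := hδ Θ Ξ hΘ hΞ
  -- the Lipschitz bound of the law between `Θ` and `cΞ`
  have hcn : ((‖c‖₊ : ℝ≥0) : ℝ≥0∞) = 1 := by
    rw [← ENNReal.coe_one, ENNReal.coe_inj, ← NNReal.coe_inj, coe_nnnorm, hc, NNReal.coe_one]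
  have hcontg : Continuous fun X => c * Ξ.ψ X := continuous_const.mul Ξ.contDiff.continuous
  have hg1 : ∫⁻ X in cellN (m + 1) L, (‖c * Ξ.ψ X‖₊ : ℝ≥0∞) ^ 2 ≤ 1 := by
    have hX : ∀ X, (‖c * Ξ.ψ X‖₊ : ℝ≥0∞) ^ 2 = (‖Ξ.ψ X‖₊ : ℝ≥0∞) ^ 2 := fun X => by
      rw [nnnorm_mul, ENNReal.coe_mul, mul_pow, hcn, one_pow, one_mul]
    simp only [hX]
    rw [Ξ.norm_eq]
  have hmain := hC.2 m L hL ((Finset.univ : Finset (Finset (Fin (m + 1)))).filter fun S => p S.card)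
    Θ.ψ (fun X => c * Ξ.ψ X) Θ.contDiff.continuous hcontg hg1 η hη0 hcell
  have hphase : ∀ S : Finset (Fin (m + 1)), compMass m L S (fun X => c * Ξ.ψ X) = compMass m L S Ξ.ψ :=
    fun S => compMass_phase_mul m L S hc Ξ.ψ
  simp only [hphase] at hmain
  exact hmain.trans (add_le_add le_rfl (ENNReal.ofReal_le_ofReal hηε))

/-- **The condensed-side masses of two near-minimisers agree within `ε`, from phase closeness** (fixed `(N, L)`,
given `CountLaw`): two-sided real form of `lawMass_le_of_phaseClose` for the predicate `(1−β)N ≤ j`; the masses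
are finite because they are bounded by the total mass `Σ_S w_S = 1` (`CountLaw` (1)). [folklore] -/
private theorem hiMass_toReal_close_of_phaseClose (hC : CountLaw) {u : ℝ → ℝ≥0∞} (m : ℕ) {L : ℝ}
    (hL : 0 < L)
    (hph : ∀ η : ℝ, 0 < η → ∃ δ : ℝ≥0∞, 0 < δ ∧ ∀ Ψ Φ : PeriodicTrialState (m + 1) L,
      periodicEnergy u Ψ ≤ periodicGroundStateEnergy u (m + 1) L + δ →
      periodicEnergy u Φ ≤ periodicGroundStateEnergy u (m + 1) L + δ →
      ∃ c : ℂ, ‖c‖ = 1 ∧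
        ∫⁻ X in cellN (m + 1) L, (‖Ψ.ψ X - c * Φ.ψ X‖₊ : ℝ≥0∞) ^ 2 ≤ ENNReal.ofReal (η ^ 2))
    (β : ℝ) {ε : ℝ} (hε : 0 < ε) :
    ∃ δ : ℝ≥0∞, 0 < δ ∧ ∀ Θ Ξ : PeriodicTrialState (m + 1) L,
      periodicEnergy u Θ ≤ periodicGroundStateEnergy u (m + 1) L + δ →
      periodicEnergy u Ξ ≤ periodicGroundStateEnergy u (m + 1) L + δ →
      (hiMass m L β Θ.ψ).toReal ≤ (hiMass m L β Ξ.ψ).toReal + ε ∧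
        (hiMass m L β Ξ.ψ).toReal ≤ (hiMass m L β Θ.ψ).toReal + ε := by
  -- adapted from `hiMass_toReal_close_of_nearMinimisers` (…GDTransferSeededLocalConstancy.lean)
  obtain ⟨δ, hδ0, hδ⟩ := lawMass_le_of_phaseClose hC m hL hph (fun j => (1 - β) * (m + 1) ≤ (j : ℝ)) hε
  have hfin : ∀ Θ : PeriodicTrialState (m + 1) L, hiMass m L β Θ.ψ ≠ ⊤ := fun Θ => by
    refine ne_top_of_le_ne_top ENNReal.one_ne_top ?_
    have h1 := (hC.1 m L hL Θ).1
    unfold hiMass lawMass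
    rw [← h1]
    exact Finset.sum_le_sum_of_subset (Finset.filter_subset _ _)
  have hreal : ∀ Θ Ξ : PeriodicTrialState (m + 1) L,
      hiMass m L β Θ.ψ ≤ hiMass m L β Ξ.ψ + ENNReal.ofReal ε →
      (hiMass m L β Θ.ψ).toReal ≤ (hiMass m L β Ξ.ψ).toReal + ε := fun Θ Ξ h => by
    have h2 := ENNReal.toReal_mono (ENNReal.add_ne_top.2 ⟨hfin Ξ, ENNReal.ofReal_ne_top⟩) h
    rwa [ENNReal.toReal_add (hfin Ξ) ENNReal.ofReal_ne_top, ENNReal.toReal_ofReal hε.le] at h2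
  exact ⟨δ, hδ0, fun Θ Ξ hΘ hΞ => ⟨hreal Θ Ξ (hδ Θ Ξ hΘ hΞ), hreal Ξ Θ (hδ Ξ Θ hΞ hΘ)⟩⟩

/-! ## The transport: (D') + (E') ⇒ closeness of the energies of `u` and `b⁻²u(·/b)` -/

/-- **Energies of `u` and of its scaled profile are close on kinetic-bounded states** (the `ScaledCloseBdd`-shaped
output of (D') + (E') for the integrable class): for a measurable profile `u` finite on `[0, ∞)`, of range `R₀`,
with lift in `L^{3/2}(ℝ³)`, at fixed `N = m + 1`, side `L > 0`, kinetic budget `K < ∞` and `ε > 0` there is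
`ϑ > 0` such that for `|b − 1| < ϑ` every periodic trial state `Φ` at side `L` with kinetic energy `≤ K` has
`E_u(Φ) ≤ E_{b⁻²u(·/b)}(Φ) + ε` and `E_{b⁻²u(·/b)}(Φ) ≤ E_u(Φ) + ε` (the sandwich of (E') periodises termwise
and sums over the pairs, `ScaledClose.periodicInteraction_le_add_of_pointwise`,
`ScaledClose.periodicEnergy_le_add_interaction`; (D') bounds the extra term). [folklore] -/
private theorem scaledClose_of_int (hPair : PairPotentialBoundInt) (hDil : DilationL32) {u : ℝ → ℝ≥0∞}
    (hu : Measurable u) (hfin : ∀ r, 0 ≤ r → u r ≠ ⊤)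
    (h32 : (∫⁻ x : Space, u ‖x‖ ^ ((3 : ℝ) / 2)) ≠ ⊤) {R₀ : ℝ} (hR₀ : ∀ r, R₀ < r → u r = 0)
    (m : ℕ) {L : ℝ} (hL : 0 < L) {K : ℝ≥0∞} (hK : K ≠ ⊤) {ε : ℝ} (hε : 0 < ε) :
    ∃ ϑ : ℝ, 0 < ϑ ∧ ∀ b : ℝ, |b - 1| < ϑ → ∀ Φ : PeriodicTrialState (m + 1) L,
      (∫⁻ X in cellN (m + 1) L, kineticDensity Φ.ψ X) ≤ K →
      periodicEnergy u Φ ≤ periodicEnergy (scaledPotential u b) Φ + ENNReal.ofReal ε ∧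
        periodicEnergy (scaledPotential u b) Φ ≤ periodicEnergy u Φ + ENNReal.ofReal ε := by
  -- adapted from `stub_scaledCloseBdd` (…GDTransferSeededScaledCloseBdd.lean)
  obtain ⟨η, hη, hηw⟩ := hPair m L hL (2 * max R₀ 0) K hK ε hε
  obtain ⟨ϑ, hϑ, hϑb⟩ := hDil u hu hfin h32 R₀ hR₀ η hη
  refine ⟨ϑ, hϑ, fun b hb Φ hΦK => ?_⟩
  obtain ⟨w, hwm, hwR, hwint, hsand₁, hsand₂⟩ := hϑb b hb
  have hW := hηw w hwm hwR hwint Φ hΦK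
  have hint₁ : ∀ X : Config (m + 1),
      periodicInteraction (scaledPotential u b) L X ≤ periodicInteraction u L X + periodicInteraction w L X :=
    fun X => ScaledClose.periodicInteraction_le_add_of_pointwise hsand₁ L X
  have hint₂ : ∀ X : Config (m + 1),
      periodicInteraction u L X ≤ periodicInteraction (scaledPotential u b) L X + periodicInteraction w L X :=
    fun X => ScaledClose.periodicInteraction_le_add_of_pointwise hsand₂ L X
  exact ⟨(ScaledClose.periodicEnergy_le_add_interaction hwm hint₂ Φ).trans (add_le_add le_rfl hW),
    (ScaledClose.periodicEnergy_le_add_interaction hwm hint₁ Φ).trans (add_le_add le_rfl hW)⟩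

/-- The kinetic energy is at most the total energy (`lintegral_kineticDensity_le_periodicEnergy` of
`Literature/…/PeriodicKineticBudget.lean`, inlined to keep the import list short). [folklore] -/
private theorem kinetic_le_periodicEnergy' {N : ℕ} {L : ℝ} (v : ℝ → ℝ≥0∞)
    (Ψ : PeriodicTrialState N L) :
    (∫⁻ X in cellN N L, kineticDensity Ψ.ψ X) ≤ periodicEnergy v Ψ :=
  lintegral_mono fun _ => le_self_add

/-! ## The stub -/

/-- **Registered stub `stub_localConstancyInt`** (line `seeded-continuity`, skeleton v7, of crux `GDTransfer`,
stmt-AtomisticToContinuum-9482): local constancy in the side `L` of the condensed-side mass of the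
near-minimisers, for measurable repulsive finite-range profiles that are finite on `[0, ∞)` with square-integrable
radial lift, given the count law and the three statements of the integrable transport device (`NearMinPhaseInt`:
finiteness of `E₀` and phase closeness of near-minimisers; `PairPotentialBoundInt` + `DilationL32`: closeness of
the energies of `u` and `b⁻²u(·/b)` on kinetic-bounded states).  Dilation transport (`PeriodicTrialState.dilate`,
`hiMass_dilate`) with the a-priori kinetic bounds `T ≤ E ≤ E₀ + η`, `≤ E₀ + 3η` of near-minimisers + near-minimiser
law stability at `(N, L₁)`. [cite: LSSY2005, Ch. 5, footnote to (5.3)] -/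
theorem stub_localConstancyInt : Sig.stub_localConstancyInt := by
  intro hPhase hPair hDil hC v hv hsq m β L₁ hL₁
  obtain ⟨hmeas, R₀, hR₀⟩ := hv
  obtain ⟨hvfin, hv2⟩ := hsq
  -- the symmetrised profile `u r = v |r|`: same energies and same radial lift, finite on all of `ℝ`
  set u : ℝ → ℝ≥0∞ := fun r => v |r| with hu
  have hu_meas : Measurable u := hmeas.comp continuous_abs.measurable
  have huR : ∀ r, R₀ < r → u r = 0 := fun r hr => hR₀ _ (hr.trans_le (le_abs_self r))
  have hu_fin : ∀ r, 0 ≤ r → u r ≠ ⊤ := fun r _ => hvfin _ (abs_nonneg r)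
  have hu_adm : IsRepulsiveFiniteRange u := ⟨hu_meas, R₀, huR⟩
  have hu2 : (∫⁻ x : Space, u ‖x‖ ^ 2) ≠ ⊤ := by simpa only [hu, abs_norm] using hv2
  -- the lift is in `L¹(ℝ³)` (for the Ky Fan gap) and in `L^{3/2}(ℝ³)` (for the transport)
  have hint1 : (∫⁻ x : Space, u ‖x‖) ≠ ⊤ := lintegral_le_of_sq hu_adm hu2
  have hint32 : (∫⁻ x : Space, u ‖x‖ ^ ((3 : ℝ) / 2)) ≠ ⊤ := lintegral_rpow_le_of_sq hu_adm hu2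
  have hE : ∀ {L : ℝ} (Φ : PeriodicTrialState (m + 1) L), periodicEnergy u Φ = periodicEnergy v Φ := by
    intro L Φ
    unfold periodicEnergy periodicInteraction periodizedPotential
    simp only [hu, abs_norm]
  have hE₀ : ∀ L : ℝ, periodicGroundStateEnergy u (m + 1) L = periodicGroundStateEnergy v (m + 1) L :=
    fun L => by
    unfold periodicGroundStateEnergy
    exact iInf_congr fun Φ => hE Φ
  -- `E₀ < ∞` and the phase closeness of near-minimisers at `(N, L₁)`: the two halves of `NearMinPhaseInt`
  obtain ⟨hE₀fin, hph⟩ := hPhase u hu_meas R₀ huR hint1 m L₁ hL₁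
  refine ⟨?_, fun ε hε => ?_⟩
  · -- the ground-state energy is finite
    rw [← hE₀]
    exact hE₀fin
  -- law stability at `(N, L₁)` for `u`, tolerance `δ`, and a real `δ' > 0` below it
  obtain ⟨δ, hδ0, hδ⟩ := hiMass_toReal_close_of_phaseClose hC m hL₁ hph β hε
  obtain ⟨δ', hδ'0, hδ'⟩ : ∃ δ' : ℝ, 0 < δ' ∧ ENNReal.ofReal δ' ≤ δ := by
    obtain ⟨q, _, hq1, hq2⟩ := ENNReal.lt_iff_exists_real_btwn.1 hδ0
    exact ⟨q, ENNReal.ofReal_pos.1 hq1, hq2.le⟩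
  -- the quarter slack `η = δ'/4`
  set η : ℝ := δ' / 4 with hη
  have hη0 : 0 < η := by positivity
  have h4η : ENNReal.ofReal η + ENNReal.ofReal η + ENNReal.ofReal η + ENNReal.ofReal η ≤ δ := by
    rw [← ENNReal.ofReal_add hη0.le hη0.le, ← ENNReal.ofReal_add (by positivity) hη0.le,
      ← ENNReal.ofReal_add (by positivity) hη0.le]
    refine le_trans (le_of_eq ?_) hδ'
    rw [hη]
    ring_nf
  -- the two finite kinetic budgets `K₀ = E₀ + η`, `K₁ = E₀ + 3η` and the corresponding `ϑ₁`, `ϑ₂`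
  have hK₀ : periodicGroundStateEnergy u (m + 1) L₁ + ENNReal.ofReal η ≠ ⊤ :=
    ENNReal.add_ne_top.2 ⟨hE₀fin, ENNReal.ofReal_ne_top⟩
  have hK₁ : periodicGroundStateEnergy u (m + 1) L₁ + ENNReal.ofReal η + ENNReal.ofReal η +
      ENNReal.ofReal η ≠ ⊤ :=
    ENNReal.add_ne_top.2 ⟨ENNReal.add_ne_top.2 ⟨hK₀, ENNReal.ofReal_ne_top⟩, ENNReal.ofReal_ne_top⟩
  obtain ⟨ϑ₁, hϑ₁0, hϑ₁⟩ := scaledClose_of_int hPair hDil hu_meas hu_fin hint32 huR m hL₁ hK₀ hη0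
  obtain ⟨ϑ₂, hϑ₂0, hϑ₂⟩ := scaledClose_of_int hPair hDil hu_meas hu_fin hint32 huR m hL₁ hK₁ hη0
  set ϑ : ℝ := min ϑ₁ ϑ₂ with hϑ
  have hϑ0 : 0 < ϑ := lt_min hϑ₁0 hϑ₂0
  -- the radius and the slack at `L₁`
  refine ⟨min (L₁ / 2) (ϑ * L₁ / 2), by positivity, ENNReal.ofReal δ', ENNReal.ofReal_pos.2 hδ'0,
    fun L' hL' => ?_⟩
  have hr1 : |L' - L₁| < L₁ / 2 := hL'.trans_le (min_le_left _ _)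
  have hr2 : |L' - L₁| < ϑ * L₁ / 2 := hL'.trans_le (min_le_right _ _)
  have hL'ge : L₁ / 2 < L' := by linarith [(abs_lt.1 hr1).1]
  have hL'pos : 0 < L' := by linarith
  set b : ℝ := L₁ / L' with hb
  have hb0 : 0 < b := div_pos hL₁ hL'pos
  have hbL : L₁ = b * L' := by rw [hb, div_mul_cancel₀ _ hL'pos.ne']
  have hb1 : |b - 1| < ϑ := by
    rw [hb, show L₁ / L' - 1 = (L₁ - L') / L' by field_simp, abs_div, abs_of_pos hL'pos,
      div_lt_iff₀ hL'pos, abs_sub_comm]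
    calc |L' - L₁| < ϑ * L₁ / 2 := hr2
      _ = ϑ * (L₁ / 2) := by ring
      _ ≤ ϑ * L' := by gcongr
  have hb1₁ : |b - 1| < ϑ₁ := hb1.trans_le (min_le_left _ _)
  have hb1₂ : |b - 1| < ϑ₂ := hb1.trans_le (min_le_right _ _)
  have hb2 : ENNReal.ofReal (b ^ 2) ≠ 0 := by simpa using hb0.ne'
  -- the slack at `L'`: `b² η`
  refine ⟨ENNReal.ofReal (b ^ 2) * ENNReal.ofReal η,
    ENNReal.mul_pos hb2 (ENNReal.ofReal_pos.2 hη0).ne', fun Ψ' Ψ₁ hΨ' hΨ₁ => ?_⟩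
  -- the dilated state: same `hiMass`, near-minimiser of the scaled potential at side `L₁`
  set Φ : PeriodicTrialState (m + 1) L₁ := Ψ'.dilate b hb0 hbL with hΦ
  have hmass : hiMass m L₁ β Φ.ψ = hiMass m L' β Ψ'.ψ := hiMass_dilate hb0 hbL β Ψ'
  have hGS : periodicGroundStateEnergy (scaledPotential u b) (m + 1) L₁ =
      (ENNReal.ofReal (b ^ 2))⁻¹ * periodicGroundStateEnergy u (m + 1) L' := by
    have h := periodicGroundStateEnergy_scaledPotential (M := L') hb0 u (m + 1)
    rwa [← hbL] at h
  have hΦsc : periodicEnergy (scaledPotential u b) Φ ≤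
      periodicGroundStateEnergy (scaledPotential u b) (m + 1) L₁ + ENNReal.ofReal η := by
    rw [hΦ, periodicEnergy_dilate hb0 hbL u Ψ', hGS, hE Ψ', hE₀ L']
    calc (ENNReal.ofReal (b ^ 2))⁻¹ * periodicEnergy v Ψ'
        ≤ (ENNReal.ofReal (b ^ 2))⁻¹ * (periodicGroundStateEnergy v (m + 1) L' +
            ENNReal.ofReal (b ^ 2) * ENNReal.ofReal η) := by gcongr
      _ = (ENNReal.ofReal (b ^ 2))⁻¹ * periodicGroundStateEnergy v (m + 1) L' + ENNReal.ofReal η := by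
          rw [mul_add, ← mul_assoc, ENNReal.inv_mul_cancel hb2 ENNReal.ofReal_ne_top, one_mul]
  -- (a) the ground-state energy of the scaled profile at side `L₁` exceeds `E₀` by at most `2η`:
  -- test an `η`-near-minimiser `Ξ` of `u` (kinetic energy `≤ E_u(Ξ) ≤ E₀ + η = K₀`) against the transport
  have hE0b : periodicGroundStateEnergy (scaledPotential u b) (m + 1) L₁ ≤
      periodicGroundStateEnergy u (m + 1) L₁ + ENNReal.ofReal η + ENNReal.ofReal η := by
    have hlt : periodicGroundStateEnergy u (m + 1) L₁ <
        periodicGroundStateEnergy u (m + 1) L₁ + ENNReal.ofReal η :=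
      ENNReal.lt_add_right hE₀fin (ENNReal.ofReal_pos.2 hη0).ne'
    obtain ⟨Ξ, hΞ⟩ := iInf_lt_iff.1 hlt
    have hT : (∫⁻ X in cellN (m + 1) L₁, kineticDensity Ξ.ψ X) ≤
        periodicGroundStateEnergy u (m + 1) L₁ + ENNReal.ofReal η :=
      (kinetic_le_periodicEnergy' u Ξ).trans hΞ.le
    calc periodicGroundStateEnergy (scaledPotential u b) (m + 1) L₁
        ≤ periodicEnergy (scaledPotential u b) Ξ := periodicGroundStateEnergy_le _ Ξ
      _ ≤ periodicEnergy u Ξ + ENNReal.ofReal η := (hϑ₁ b hb1₁ Ξ hT).2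
      _ ≤ periodicGroundStateEnergy u (m + 1) L₁ + ENNReal.ofReal η + ENNReal.ofReal η :=
          add_le_add hΞ.le le_rfl
  -- (b) the a-priori kinetic bound of the dilated near-minimiser: `T(Φ) ≤ E_{u_b}(Φ) ≤ E₀ + 3η = K₁`
  have hTΦ : (∫⁻ X in cellN (m + 1) L₁, kineticDensity Φ.ψ X) ≤
      periodicGroundStateEnergy u (m + 1) L₁ + ENNReal.ofReal η + ENNReal.ofReal η + ENNReal.ofReal η :=
    calc (∫⁻ X in cellN (m + 1) L₁, kineticDensity Φ.ψ X)
        ≤ periodicEnergy (scaledPotential u b) Φ := kinetic_le_periodicEnergy' _ Φ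
      _ ≤ periodicGroundStateEnergy (scaledPotential u b) (m + 1) L₁ + ENNReal.ofReal η := hΦsc
      _ ≤ periodicGroundStateEnergy u (m + 1) L₁ + ENNReal.ofReal η + ENNReal.ofReal η +
            ENNReal.ofReal η := add_le_add hE0b le_rfl
  -- so `Φ` and `Ψ₁` are `δ`-near-minimisers of `u` at `(N, L₁)`
  have hΦnear : periodicEnergy u Φ ≤ periodicGroundStateEnergy u (m + 1) L₁ + δ :=
    calc periodicEnergy u Φ
        ≤ periodicEnergy (scaledPotential u b) Φ + ENNReal.ofReal η := (hϑ₂ b hb1₂ Φ hTΦ).1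
      _ ≤ periodicGroundStateEnergy (scaledPotential u b) (m + 1) L₁ + ENNReal.ofReal η +
            ENNReal.ofReal η := add_le_add hΦsc le_rfl
      _ ≤ periodicGroundStateEnergy u (m + 1) L₁ + ENNReal.ofReal η + ENNReal.ofReal η +
            ENNReal.ofReal η + ENNReal.ofReal η := add_le_add (add_le_add hE0b le_rfl) le_rfl
      _ = periodicGroundStateEnergy u (m + 1) L₁ + (ENNReal.ofReal η + ENNReal.ofReal η +
            ENNReal.ofReal η + ENNReal.ofReal η) := by simp only [add_assoc]
      _ ≤ periodicGroundStateEnergy u (m + 1) L₁ + δ := add_le_add le_rfl h4η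
  have hΨ₁near : periodicEnergy u Ψ₁ ≤ periodicGroundStateEnergy u (m + 1) L₁ + δ := by
    rw [hE, hE₀]
    exact hΨ₁.trans (add_le_add le_rfl hδ')
  have h := hδ Φ Ψ₁ hΦnear hΨ₁near
  rwa [hmass] at h

end Summit.AtomisticToContinuum.BoseEinsteinCondensation.Cruxes.GDTransfer.Seeded

end
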